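import Summits.CriticalPhenomena.PercolationContinuityZ3.Theorems.PercNearOneGluingNoHeavyQuantFarSunGameLink
import Summits.CriticalPhenomena.PercolationContinuityZ3.Theorems.PercNearOneGluingNoHeavyQuantFarSunWitnessAvgSplit
import Summits.CriticalPhenomena.PercolationContinuityZ3.Theorems.PercNearOneGluingNoHeavyQuantFarSunVertex
import Summits.CriticalPhenomena.PercolationContinuityZ3.Theorems.PercNearOneGluingNoHeavyQuantFarSunLawSums
import Mathlib.Algebra.BigOperators.Group.Finset.Sigma
import Mathlib.Tactic.FieldSimp
import Mathlib.Tactic.Ring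
import Mathlib.Tactic.Linarith
import Mathlib.Tactic.Positivity
import HarnessLib

/-!
# FAR beyond trees: `G_avg − 1` IS the mean flank payoff — game certificates give `witGavg ≥ 1` on boxes and cell boxes

builds on p205010 (kernel theorem, internal audit signed; external expert review pending)

Support file (`--supports stmt-CriticalPhenomena-4575`), seat `prim-cert-1` (gen 39); memo `prim-cert-1/FROM-prim-cert-1-g39-VERTEX-GAME.md` §1, §4 (L2, L5).
Continues `…QuantFarSunGameLink` (certificate ⇒ mean flank payoff `≥ 0` at certified words), `…QuantFarSunWitnessAvgSplit` (`G_avg = mass + boost`)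
and `…QuantFarSunVertex` (the vertex principle).

* `HairyCycle.kernelPay K Q = Σ_{k<K, k∉Q} witAvgKernel 2 (insert k Q) k − 𝟙[#Q ≤ 4]` and **`HairyCycle.witGavg_sub_one_eq_sum_kernelPay`**:
  `witGavg K h 2 − 1 = Σ_{Q ⊆ range K} hairW K h Q · kernelPay K Q` (no dead hair) — `G_avg − 1` is a pattern expectation.
* `HairyCycle.card_wit_two_add_four_le` (`#wit 2 P + 4 ≤ #P` for `#P ≥ 4`: the two least and two greatest members are not witnesses),
  `HairyCycle.mem_wit_two_insert_iff`, **`HairyCycle.flankPay_le_kernelPay`** (the automaton's credit `1/(#Q−3)` per flanked closed hair is at most the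
  kernel's `1/#wit`).
* **`HairyCycle.witGavg_ge_one_of_cellCert`** — if `g_{c k} ≤ h k ≤ g_{c k + 1}` (`k < K`, letters `g_i = k_i/q` of a well-formed game, `0 < h`) and EVERY word
  `u` with `u k ∈ {c k, c k + 1}` has its weight certified (`gameCert`), then `1 ≤ witGavg K h 2` (vertex principle + the two files above).
  **`HairyCycle.witGavg_ge_one_of_boxCert`** — the binary special case: letters `[(kη,0),(q,1)]`, all budgets `0..K` certified ⇒ `1 ≤ witGavg K h 2`
  on the whole box `kη/q ≤ h k ≤ 1`.
Elementary [this work]; no sorries; standard axioms.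
-/

noncomputable section

namespace Summit.CriticalPhenomena.PercolationContinuityZ3.Theorems.HairyCycle

open Finset

variable {K : ℕ}

/-! ## `G_avg − 1` as a pattern expectation -/

/-- The kernel form of the flank payoff: `Σ_{k<K, k∉Q} witAvgKernel 2 (insert k Q) k − 𝟙[#Q ≤ 4]`. [this work] -/
def kernelPay (K : ℕ) (Q : Finset ℕ) : ℝ :=
  (∑ k ∈ (range K).filter (fun k => k ∉ Q), witAvgKernel 2 (insert k Q) k) - (if Q.card ≤ 4 then 1 else 0)

/-- **`witGavg K h 2 − 1 = Σ_Q hairW K h Q · kernelPay K Q`** (no dead hair: `0 < h k` for `k < K`). [this work] -/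
theorem witGavg_sub_one_eq_sum_kernelPay {h : ℕ → ℝ} (hpos : ∀ k, k < K → 0 < h k) :
    witGavg K h 2 - 1 = ∑ Q ∈ (range K).powerset, hairW K h Q * kernelPay K Q := by
  rw [sub_eq_iff_eq_add, witGavg_eq_mass_add_boost hpos 2]
  have hone := sum_hairW_eq_one (K := K) h
  conv_rhs => rw [← hone]
  -- swap the boost double sum
  have hswap : ∑ k ∈ range K, ∑ Q ∈ ((range K).erase k).powerset, hairW K h Q * witAvgKernel 2 (insert k Q) k =
      ∑ Q ∈ (range K).powerset, ∑ k ∈ (range K).filter (fun k => k ∉ Q), hairW K h Q * witAvgKernel 2 (insert k Q) k := by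
    refine Finset.sum_comm' fun k Q => ?_
    rw [Finset.mem_powerset, Finset.mem_powerset, Finset.mem_filter, Finset.subset_erase]
    constructor
    · rintro ⟨hk, hQ, hkQ⟩; exact ⟨⟨hk, hkQ⟩, hQ⟩
    · rintro ⟨⟨hk, hkQ⟩, hQ⟩; exact ⟨hk, hQ, hkQ⟩
  rw [hswap, ← Finset.sum_add_distrib, ← Finset.sum_add_distrib]
  refine Finset.sum_congr rfl fun Q _ => ?_
  rw [← Finset.mul_sum]
  unfold kernelPay
  -- `wit 2 Q ≠ ∅ ⟺ 5 ≤ #Q`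
  by_cases hne : (wit 2 Q).Nonempty
  · have h5 : ¬ Q.card ≤ 4 := fun h4 => by
      -- a witness has 2 members below, itself, and 2 above
      obtain ⟨d, hd⟩ := hne
      obtain ⟨hdQ, hb, ha⟩ := Finset.mem_filter.1 hd
      have hsplit := Finset.card_filter_add_card_filter_not (s := Q) (fun e => e < d)
      have hsub : (Q.filter fun e => d < e) ⊆ (Q.filter fun e => ¬ e < d).erase d := by
        intro e he
        rw [Finset.mem_filter] at he
        rw [Finset.mem_erase, Finset.mem_filter]
        exact ⟨ne_of_gt he.2, he.1, not_lt.2 he.2.le⟩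
      have hcard := Finset.card_le_card hsub
      rw [Finset.card_erase_of_mem (Finset.mem_filter.2 ⟨hdQ, lt_irrefl d⟩)] at hcard
      omega
    rw [if_pos hne, if_neg h5]
    ring
  · have h4 : Q.card ≤ 4 := card_le_of_wit_not_nonempty hne
    rw [if_neg hne, if_pos h4]
    ring

/-! ## The automaton's flank payoff is below the kernel payoff -/

/-- `k` is a witness of `insert k Q` at layer 2 iff at least two members of `Q` lie below `k` and two above. [this work] -/
theorem mem_wit_two_insert_iff {Q : Finset ℕ} {k : ℕ} :
    k ∈ wit 2 (insert k Q) ↔ 2 ≤ (Q.filter fun e => e < k).card ∧ 2 ≤ (Q.filter fun e => k < e).card := by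
  unfold wit
  rw [Finset.mem_filter]
  have hb : (insert k Q).filter (fun e => e < k) = Q.filter fun e => e < k := by
    rw [Finset.filter_insert, if_neg (lt_irrefl k)]
  have ha : (insert k Q).filter (fun e => k < e) = Q.filter fun e => k < e := by
    rw [Finset.filter_insert, if_neg (lt_irrefl k)]
  rw [hb, ha]
  exact ⟨fun h => h.2, fun h => ⟨Finset.mem_insert_self k Q, h⟩⟩

/-- **At most `#P − 4` witnesses**: the two least members have ≤ 1 member below, the two greatest ≤ 1 above, and (for `#P ≥ 4`) these four are
distinct non-witnesses. [this work] -/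
theorem card_wit_two_add_four_le {P : Finset ℕ} (hP : 4 ≤ P.card) : (wit 2 P).card + 4 ≤ P.card := by
  -- low := members with ≤ 1 below; high := members with ≤ 1 above
  set low := P.filter (fun e => (P.filter fun x => x < e).card ≤ 1) with hlow
  set high := P.filter (fun e => (P.filter fun x => e < x).card ≤ 1) with hhigh
  have hPne : P.Nonempty := Finset.card_pos.1 (by omega)
  -- two members of `low`: the minimum and the minimum of the rest
  have h2low : 2 ≤ low.card := by
    set m₁ := P.min' hPne with hm₁
    have hm₁P : m₁ ∈ P := Finset.min'_mem P hPne
    have hP'ne : (P.erase m₁).Nonempty := by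
      rw [← Finset.card_pos, Finset.card_erase_of_mem hm₁P]; omega
    set m₂ := (P.erase m₁).min' hP'ne with hm₂
    have hm₂P' : m₂ ∈ P.erase m₁ := Finset.min'_mem _ hP'ne
    have hm₂P : m₂ ∈ P := (Finset.mem_erase.1 hm₂P').2
    have hne12 : m₂ ≠ m₁ := (Finset.mem_erase.1 hm₂P').1
    have hm₁low : m₁ ∈ low := by
      rw [hlow, Finset.mem_filter]
      refine ⟨hm₁P, ?_⟩
      have : P.filter (fun x => x < m₁) = ∅ :=
        Finset.filter_eq_empty_iff.2 fun x hx hlt => absurd (Finset.min'_le P x hx) (not_le.2 (hm₁ ▸ hlt))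
      rw [this]; simp
    have hm₂low : m₂ ∈ low := by
      rw [hlow, Finset.mem_filter]
      refine ⟨hm₂P, ?_⟩
      have hsub : P.filter (fun x => x < m₂) ⊆ {m₁} := by
        intro x hx
        rw [Finset.mem_filter] at hx
        rw [Finset.mem_singleton]
        by_contra hxm
        have hx' : x ∈ P.erase m₁ := Finset.mem_erase.2 ⟨hxm, hx.1⟩
        exact absurd (Finset.min'_le _ x hx') (not_le.2 (hm₂ ▸ hx.2))
      exact le_trans (Finset.card_le_card hsub) (by simp)
    have : ({m₁, m₂} : Finset ℕ) ⊆ low := by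
      intro x hx
      rcases Finset.mem_insert.1 hx with rfl | hx
      · exact hm₁low
      · rw [Finset.mem_singleton] at hx; exact hx ▸ hm₂low
    have hc : ({m₁, m₂} : Finset ℕ).card = 2 := by
      rw [Finset.card_insert_of_notMem (by rw [Finset.mem_singleton]; exact hne12.symm), Finset.card_singleton]
    exact hc ▸ Finset.card_le_card this
  -- two members of `high`: symmetric
  have h2high : 2 ≤ high.card := by
    set M₁ := P.max' hPne with hM₁
    have hM₁P : M₁ ∈ P := Finset.max'_mem P hPne
    have hP'ne : (P.erase M₁).Nonempty := by
      rw [← Finset.card_pos, Finset.card_erase_of_mem hM₁P]; omega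
    set M₂ := (P.erase M₁).max' hP'ne with hM₂
    have hM₂P' : M₂ ∈ P.erase M₁ := Finset.max'_mem _ hP'ne
    have hM₂P : M₂ ∈ P := (Finset.mem_erase.1 hM₂P').2
    have hne12 : M₂ ≠ M₁ := (Finset.mem_erase.1 hM₂P').1
    have hM₁high : M₁ ∈ high := by
      rw [hhigh, Finset.mem_filter]
      refine ⟨hM₁P, ?_⟩
      have : P.filter (fun x => M₁ < x) = ∅ :=
        Finset.filter_eq_empty_iff.2 fun x hx hlt => absurd (Finset.le_max' P x hx) (not_le.2 (hM₁ ▸ hlt))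
      rw [this]; simp
    have hM₂high : M₂ ∈ high := by
      rw [hhigh, Finset.mem_filter]
      refine ⟨hM₂P, ?_⟩
      have hsub : P.filter (fun x => M₂ < x) ⊆ {M₁} := by
        intro x hx
        rw [Finset.mem_filter] at hx
        rw [Finset.mem_singleton]
        by_contra hxm
        have hx' : x ∈ P.erase M₁ := Finset.mem_erase.2 ⟨hxm, hx.1⟩
        exact absurd (Finset.le_max' _ x hx') (not_le.2 (hM₂ ▸ hx.2))
      exact le_trans (Finset.card_le_card hsub) (by simp)
    have : ({M₁, M₂} : Finset ℕ) ⊆ high := by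
      intro x hx
      rcases Finset.mem_insert.1 hx with rfl | hx
      · exact hM₁high
      · rw [Finset.mem_singleton] at hx; exact hx ▸ hM₂high
    have hc : ({M₁, M₂} : Finset ℕ).card = 2 := by
      rw [Finset.card_insert_of_notMem (by rw [Finset.mem_singleton]; exact hne12.symm), Finset.card_singleton]
    exact hc ▸ Finset.card_le_card this
  -- `low ∩ high = ∅` (an element of both would see at most `1 + 1 + 1 = 3` members), and witnesses avoid both
  have hdisj : Disjoint low high := by
    rw [Finset.disjoint_left]
    intro e hel heh
    rw [hlow, Finset.mem_filter] at hel
    rw [hhigh, Finset.mem_filter] at heh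
    have hsplit := Finset.card_filter_add_card_filter_not (s := P) (fun x => x < e)
    have hsub : (P.filter fun x => ¬ x < e) ⊆ insert e (P.filter fun x => e < x) := by
      intro x hx
      rw [Finset.mem_filter] at hx
      rw [Finset.mem_insert, Finset.mem_filter]
      rcases lt_or_eq_of_le (not_lt.1 hx.2) with h | h
      · exact Or.inr ⟨hx.1, h⟩
      · exact Or.inl h.symm
    have := le_trans (Finset.card_le_card hsub) (Finset.card_insert_le _ _)
    omega
  have hwit : wit 2 P ⊆ P \ (low ∪ high) := by
    intro d hd
    obtain ⟨hdP, hb, ha⟩ := Finset.mem_filter.1 hd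
    rw [Finset.mem_sdiff, Finset.mem_union, hlow, hhigh, Finset.mem_filter, Finset.mem_filter]
    exact ⟨hdP, fun hc => by rcases hc with ⟨_, hc⟩ | ⟨_, hc⟩ <;> omega⟩
  have hlu : low ∪ high ⊆ P := Finset.union_subset (Finset.filter_subset _ _) (Finset.filter_subset _ _)
  have h1 := Finset.card_le_card hwit
  rw [Finset.card_sdiff_of_subset hlu, Finset.card_union_of_disjoint hdisj] at h1
  have h2 := Finset.card_le_card hlu
  rw [Finset.card_union_of_disjoint hdisj] at h2
  omega

/-- **The flank payoff is below the kernel payoff** (any pattern): each flanked closed hair earns `1/#wit(insert k Q) ≥ 1/(#Q − 3)`. [this work] -/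
theorem flankPay_le_kernelPay (Q : Finset ℕ) : flankPay K Q ≤ kernelPay K Q := by
  unfold flankPay kernelPay
  have hker_nonneg : ∀ k, 0 ≤ witAvgKernel 2 (insert k Q) k := fun k => by
    unfold witAvgKernel; split_ifs <;> positivity
  gcongr ?_ - _
  by_cases h4 : 4 ≤ Q.card
  · rw [if_pos h4]
    have hden : (0 : ℝ) < (Q.card : ℝ) - 3 := by
      have : (4 : ℝ) ≤ Q.card := by exact_mod_cast h4
      linarith
    -- restrict the kernel sum to the flanked positions, where each term is `≥ 1/(#Q − 3)`
    set Fset := (range K).filter (fun k => k ∉ Q ∧ 2 ≤ (Q.filter fun e => e < k).card ∧ 2 ≤ (Q.filter fun e => k < e).card) with hF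
    have hFsub : Fset ⊆ (range K).filter fun k => k ∉ Q := Finset.monotone_filter_right _ fun k _ hk => hk.1
    have hterm : ∀ k ∈ Fset, 1 / ((Q.card : ℝ) - 3) ≤ witAvgKernel 2 (insert k Q) k := by
      intro k hk
      rw [hF, Finset.mem_filter] at hk
      obtain ⟨_, hkQ, hb, ha⟩ := hk
      have hw : k ∈ wit 2 (insert k Q) := mem_wit_two_insert_iff.2 ⟨hb, ha⟩
      unfold witAvgKernel
      rw [if_pos hw]
      have hcard : (insert k Q).card = Q.card + 1 := Finset.card_insert_of_notMem hkQ
      have hle := card_wit_two_add_four_le (P := insert k Q) (by omega)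
      have hpos : 0 < (wit 2 (insert k Q)).card := Finset.card_pos.2 ⟨k, hw⟩
      have h1 : ((wit 2 (insert k Q)).card : ℝ) ≤ (Q.card : ℝ) - 3 := by
        have : ((wit 2 (insert k Q)).card : ℝ) + 4 ≤ (Q.card : ℝ) + 1 := by exact_mod_cast hcard ▸ hle
        linarith
      have h2 : (0 : ℝ) < (wit 2 (insert k Q)).card := by exact_mod_cast hpos
      exact one_div_le_one_div_of_le h2 h1
    calc (flankCount K Q : ℝ) / ((Q.card : ℝ) - 3) = ∑ k ∈ Fset, 1 / ((Q.card : ℝ) - 3) := by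
          rw [Finset.sum_const, nsmul_eq_mul]
          unfold flankCount
          ring
      _ ≤ ∑ k ∈ Fset, witAvgKernel 2 (insert k Q) k := Finset.sum_le_sum hterm
      _ ≤ ∑ k ∈ (range K).filter (fun k => k ∉ Q), witAvgKernel 2 (insert k Q) k :=
          Finset.sum_le_sum_of_subset_of_nonneg hFsub fun k _ _ => hker_nonneg k
  · rw [if_neg h4]
    exact Finset.sum_nonneg fun k _ => hker_nonneg k

/-! ## Certificates on cell boxes ⇒ `witGavg ≥ 1` -/

/-- Letter probabilities lie in `[0,1]` (also for junk indices). [this work] -/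
theorem gOf_mem_unit {P : GameSpec} (W : P.WF) (i : ℕ) : 0 ≤ P.gOf i ∧ P.gOf i ≤ 1 := by
  unfold GameSpec.gOf
  have hq : (0 : ℝ) < P.q := by exact_mod_cast W.q_pos
  refine ⟨div_nonneg (Nat.cast_nonneg _) hq.le, (div_le_one hq).2 ?_⟩
  by_cases hi : i < P.nL
  · exact_mod_cast W.k_le i hi
  · have : P.kOf i = 0 := by
      unfold GameSpec.kOf
      rw [List.getD_eq_default _ _ (by unfold GameSpec.nL at hi; omega)]
    rw [this]; exact_mod_cast hq.le

/-- **CELL-BOX CERTIFICATE ⇒ `witGavg ≥ 1`.**  Let `P` be a well-formed game (`5 ≤ Amax`, `K ≤ Kcred`, `2 ≤ K`) with a passed certificate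
`gameCert NB K Bs`, and `c : ℕ → ℕ` a cell assignment (`c k + 1 < nL`) such that every word `u` with `u k ∈ {c k, c k + 1}` (`k < K`) has weight in
`Bs` and `≤ NB`.  Then every `h` with `g_{c k} ≤ h k ≤ g_{c k+1}` and `0 < h k` (`k < K`) has `1 ≤ witGavg K h 2`. [this work] -/
theorem witGavg_ge_one_of_cellCert {P : GameSpec} (W : P.WF) (hA5 : 5 ≤ P.Amax) {NB : ℕ} (hKc : K ≤ P.Kcred) (hK : 2 ≤ K)
    {Bs : List ℕ} (hc : P.gameCert NB K Bs = true) (c : ℕ → ℕ) (hcL : ∀ k, k < K → c k + 1 < P.nL)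
    (hB : ∀ u : ℕ → ℕ, (∀ k, k < K → u k = c k ∨ u k = c k + 1) →
      (((List.range K).map u).map P.wOf).sum ∈ Bs ∧ (((List.range K).map u).map P.wOf).sum ≤ NB)
    {h : ℕ → ℝ} (hh : ∀ k, k < K → P.gOf (c k) ≤ h k ∧ h k ≤ P.gOf (c k + 1)) (hpos : ∀ k, k < K → 0 < h k) :
    1 ≤ witGavg K h 2 := by
  -- `hairW` only reads `h` below `K`
  have hWc : ∀ {g g' : ℕ → ℝ}, (∀ k, k < K → g k = g' k) → ∀ Q, hairW K g Q = hairW K g' Q :=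
    fun hg Q => Finset.prod_congr rfl fun k hk => by rw [hg k (Finset.mem_range.1 hk)]
  have key : 0 ≤ ∑ Q ∈ (range K).powerset, hairW K h Q * kernelPay K Q := by
    refine patE_vertex (K := K) (kernelPay K) (a := fun k => P.gOf (c k)) (b := fun k => P.gOf (c k + 1)) (fun v hv => ?_) hh
    -- the vertex `v` is the configuration of the word `u k = c k` or `c k + 1`
    classical
    let u : ℕ → ℕ := fun k => if v k = P.gOf (c k) then c k else c k + 1
    have hu : ∀ k, k < K → u k = c k ∨ u k = c k + 1 := fun k _ => by
      simp only [u]; split_ifs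
      · exact Or.inl rfl
      · exact Or.inr rfl
    have huv : ∀ k, k < K → P.gOf (u k) = v k := fun k hk => by
      simp only [u]
      split_ifs with hvk
      · exact hvk.symm
      · rcases hv k hk with h1 | h2
        · exact absurd h1 hvk
        · exact h2.symm
    set word := (List.range K).map u with hword
    have hwlen : word.length = K := by simp [hword]
    have hwmem : ∀ i ∈ word, i < P.nL := by
      intro i hi
      rw [hword, List.mem_map] at hi
      obtain ⟨k, hk, rfl⟩ := hi
      rcases hu k (List.mem_range.1 hk) with e | e <;> rw [e] <;> have := hcL k (List.mem_range.1 hk) <;> omega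
    have h0 := sum_hairW_flankPay_nonneg_of_gameCert W hA5 hKc hc hK word hwmem hwlen (hB u hu).1 (hB u hu).2
    have hcfg : ∀ k, k < K → (fun k => P.gOf (word.getD k 0)) k = v k := fun k hk => by
      simp only [hword]
      rw [List.getD_eq_getElem _ _ (by simpa using hk)]
      simp [huv k hk]
    calc (0 : ℝ) ≤ ∑ Q ∈ (range K).powerset, hairW K (fun k => P.gOf (word.getD k 0)) Q * flankPay K Q := h0
      _ ≤ ∑ Q ∈ (range K).powerset, hairW K (fun k => P.gOf (word.getD k 0)) Q * kernelPay K Q :=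
          Finset.sum_le_sum fun Q _ => mul_le_mul_of_nonneg_left (flankPay_le_kernelPay Q)
            (hairW_nonneg (fun k _ => gOf_mem_unit W _) Q)
      _ = ∑ Q ∈ (range K).powerset, hairW K v Q * kernelPay K Q :=
          Finset.sum_congr rfl fun Q _ => by rw [hWc hcfg Q]
  have := witGavg_sub_one_eq_sum_kernelPay hpos
  linarith

/-- **BOX CERTIFICATE ⇒ `witGavg ≥ 1` (binary alphabet).**  For the game with letters `[(kη, 0), (q, 1)]` (well formed, `5 ≤ Amax`, `K ≤ Kcred`,
`2 ≤ K`, `0 < kη`) whose certificate passes for all budgets `0, …, K` (table size `NB ≥ K`): `1 ≤ witGavg K h 2` for every `h` with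
`kη/q ≤ h k ≤ 1` (`k < K`). [this work] -/
theorem witGavg_ge_one_of_boxCert {P : GameSpec} (W : P.WF) (hA5 : 5 ≤ P.Amax) {NB : ℕ} (hKc : K ≤ P.Kcred) (hK : 2 ≤ K) (hNB : K ≤ NB)
    {kη : ℕ} (hkη : 0 < kη) (hP : P.letters = [(kη, 0), (P.q, 1)]) (hc : P.gameCert NB K (List.range (K + 1)) = true)
    {h : ℕ → ℝ} (hh : ∀ k, k < K → (kη : ℝ) / P.q ≤ h k ∧ h k ≤ 1) : 1 ≤ witGavg K h 2 := by
  have hnL : P.nL = 2 := by unfold GameSpec.nL; rw [hP]; rfl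
  have hg0 : P.gOf 0 = (kη : ℝ) / P.q := by unfold GameSpec.gOf GameSpec.kOf; rw [hP]; rfl
  have hq0 : (0 : ℝ) < P.q := by exact_mod_cast W.q_pos
  have hg1 : P.gOf 1 = 1 := by
    unfold GameSpec.gOf GameSpec.kOf; rw [hP]
    simp only [List.getD_cons_succ, List.getD_cons_zero]
    exact div_self hq0.ne'
  have hw0 : P.wOf 0 = 0 := by unfold GameSpec.wOf; rw [hP]; rfl
  have hw1 : P.wOf 1 = 1 := by unfold GameSpec.wOf; rw [hP]; rfl
  -- weight of a binary word = number of letters `1` ≤ K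
  have hwt : ∀ u : ℕ → ℕ, (∀ k, k < K → u k = 0 ∨ u k = 0 + 1) → (((List.range K).map u).map P.wOf).sum ≤ K := by
    intro u hu
    have : ∀ x ∈ ((List.range K).map u).map P.wOf, x ≤ 1 := by
      intro x hx
      simp only [List.map_map, List.mem_map, List.mem_range, Function.comp] at hx
      obtain ⟨k, hk, rfl⟩ := hx
      rcases hu k hk with e | e <;> simp [e, hw0, hw1]
    have hlen : (((List.range K).map u).map P.wOf).length = K := by simp
    calc (((List.range K).map u).map P.wOf).sum ≤ (((List.range K).map u).map P.wOf).length * 1 :=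
          List.sum_le_card_nsmul _ _ this |>.trans (by simp)
      _ = K := by rw [hlen, mul_one]
  refine witGavg_ge_one_of_cellCert W hA5 hKc hK hc (fun _ => 0) (fun k _ => by rw [hnL]; norm_num) (fun u hu => ?_)
    (fun k hk => by rw [hg0, Nat.zero_add, hg1]; exact hh k hk) (fun k hk => lt_of_lt_of_le (by positivity) (hh k hk).1)
  exact ⟨List.mem_range.2 (Nat.lt_succ_of_le (hwt u hu)), (hwt u hu).trans hNB⟩

end Summit.CriticalPhenomena.PercolationContinuityZ3.Theorems.HairyCycle

end
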